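import Summits.QuantumFields.BalabanUV.Beta.GAN24.RespStepCauchy

/-!
# `BalabanUV.Beta.GAN24.RespStepRefine` — binder row G-an2-4 / (CONV-C), the row owner's CONTACT-TERM ROUTE, step CT-4c (`gen19/CT4-DESIGN-v0.md` §2 (β)+(ε)),
# **THE UNDRESSED ONE-SHOT LEG OF THE TALLER TOWER AT A FINE′ BOND AGAINST THE SHORTER TOWER's LEG AT ITS `Lc`-CELL — POINTWISE, GEOMETRIC**
# (the T-N1C team's «(N1-Cauchy)» in its BLOCK-SAMPLE form `FineReadoutCauchyDecThree.blockSample_cauchy_three`, read in `respStep` currency with the source translated)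

NOT IN PRINT; OUR BOOKKEEPING (G-an2-4 formalisation swarm, leaf prover `b2b-balaban-gan24-formalise-leaf-01`, gen 61; «MINE (CT-4c-A)» journal W-leaf01-g61-2
l.35460; design `HOME/b2b-balaban-gan24-formalise-leaf-01/g61/CT4CE-BLUEPRINT-v0.md` §1 (Lβε), module M1).  HONEST FRAMING (cell contract, verbatim): «discharging
`BetaPertH` makes Bałaban's UV stability UNCONDITIONAL — a real constructive-QFT result; it is NOT the continuum limit and NOT the Clay problem.»  HONEST DEPENDENCY
(verbatim): «continuum YM on T⁴ ⇐ BetaPertH ∧ nine spine estimates (0/9 proved); BetaPertH ⇐ (D1) ∧ (D4) ∧ CAP+tail; G-an2-4 gates asym, D1 and NE2/3/4.»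

WHAT (`d = 3`, `m = 0` — the cubic-Wilson sector's undressed legs `B_k = respStep 1 (Lc^(k+1))`, `B_{k+1} = respStep 1 (Lc^(k+2))`; TOP-ALIGNED: the source bond `(μ, z)`
on the common top lattice, the fine′ bond `(l, v)` of member `k+1` against the bond `(l, quo Lc v)` of member `k` — its `Lc`-cell):
* §1 (generic `d`) `quo_sub_mul_zsmul` — the source translation commutes with the cell label: `quo Lc (v − (Lc·N)•z) = quo Lc v − N•z`.
* §2 (`d = 3`, every `Lc ≥ 2`, NO hypothesis) **`exists_respStep_refine_unit`**: ONE rate `θ < 1`, decay rate `κ₂ > 0`, constant `c ≥ 0` with, for ALL `k μ z l v`,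
  `|(Lc^{k+2})^5·respStep 1 (Lc^(k+2)) μ z l v − (Lc^{k+1})^5·respStep 1 (Lc^(k+1)) μ z l (quo Lc v)| ≤ c·θ^k·e^{−κ₂‖quo (Lc^(k+2)) v − z‖∞}` — the UNIT legs of two
  consecutive members agree POINTWISE up to `θ^k` (the cell-mean defect (β) AND the intra-cell oscillation (ε) of the design in ONE letter: this is exactly what the
  block-SAMPLE form of «(N1-Cauchy)» says); **`exists_respStep_refine`**: the same in the legs' native currency,
  `|Lc^5·respStep 1 (Lc^(k+2)) μ z l v − respStep 1 (Lc^(k+1)) μ z l (quo Lc v)| ≤ c·θ^k·((Lc^{k+1})^5)⁻¹·e^{−κ₂‖quo (Lc^(k+2)) v − z‖∞}`.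
[folklore] throughout: `blockSample_cauchy_three` (T-N1C team, leaf-19 ∕ leaf-04 lineage) BY NAME + leaf-12's `respStep_one` + `quo_add_zsmul`; 0 `def`, 0 cited facts,
0 `def … : Prop`, 0 sorry.  NO estimate of Bałaban's re-derived; discharges NOTHING of hSdev ∕ (hS, hSall) by itself — it is the leg input of the SHAPE-A atom differences
of CT-4c (blueprint §2); the fine′ label `quo (Lc^(k+2)) v = quo (Lc^(k+1)) (quo Lc v)` is `FineReadoutCauchyDecLegs.quo_pow_succ_eq`; base `m > 0` (born sectors) is NOT
covered (the `Lc^m`-contours of the two towers do not pair point by point); 0 wall binders; NEVER «G-an2-4 closed»; NOT D1, NOT BetaPertH, NOT continuum, NOT Clay.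
-/

noncomputable section

open Finset
open scoped BigOperators
open Literature.MathematicalPhysics.QuantumFieldTheory
open Literature.MathematicalPhysics.QuantumFieldTheory.LatticeForm (quo)
open Literature.MathematicalPhysics.QuantumFieldTheory.Balaban1983to89
open Literature.MathematicalPhysics.QuantumFieldTheory.Balaban1983to89.Beta
open B12Sec2to5 (l1)
open B4ContourShift (supNorm)
open KernelSpecInstance (wH)
open AffineAveraging (Site)
open BlochFibreUniqueness (quo_add_zsmul)
open BalabanCompositeJets (respStep)
open Summit.QuantumFields.BalabanUV.Beta.GAN24.RespStepDecay (respStep_one)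
open Summit.QuantumFields.BalabanUV.Beta.GAN24.RespStepCauchy (supNorm_le_l1)
open Summit.QuantumFields.BalabanUV.Beta.GAN24.FineReadoutCauchyDecThree (blockSample_cauchy_three)

namespace Summit.QuantumFields.BalabanUV.Beta.GAN24.RespStepRefine

variable {d : ℕ}

/-! ## §1 The source translation commutes with the cell label (generic `d`) -/

/-- [folklore] `quo Lc (v − (Lc·N)•z) = quo Lc v − N•z` (`quo_add_zsmul`: the cell label is affine under translations by `Lc`-multiples). -/
theorem quo_sub_mul_zsmul (Lc N : ℕ) [NeZero Lc] (v z : Site (d + 1)) :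
    quo Lc (v - ((Lc * N : ℕ) : ℤ) • z) = quo Lc v - (N : ℤ) • z := by
  have e : ((Lc * N : ℕ) : ℤ) • z = (Lc : ℤ) • ((N : ℤ) • z) := by
    rw [smul_smul]
    push_cast
    rfl
  rw [e, sub_eq_add_neg, ← smul_neg, quo_add_zsmul, ← sub_eq_add_neg]

/-! ## §2 `d = 3`: the undressed legs of two consecutive members agree pointwise on the cells, geometrically -/

section Four

variable {Lc : ℕ} [NeZero Lc]

/-- NOT IN PRINT; OUR BOOKKEEPING ([folklore] packaging of the T-N1C team's `blockSample_cauchy_three` BY NAME).  **THE UNIT UNDRESSED LEGS OF TWO CONSECUTIVE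
MEMBERS AGREE POINTWISE ON THE `Lc`-CELLS, UP TO `θ^k`** (`d = 3`, every `Lc ≥ 2`, `m = 0`, top-aligned): ONE rate `θ < 1`, decay rate `κ₂ > 0` and constant `c ≥ 0`
with, for ALL relative depths `k`, source bonds `(μ, z)`, fine′ bonds `(l, v)` of member `k+1`,
`|(Lc^{k+2})^5·respStep 1 (Lc^(k+2)) μ z l v − (Lc^{k+1})^5·respStep 1 (Lc^(k+1)) μ z l (quo Lc v)| ≤ c·θ^k·e^{−κ₂‖quo (Lc^(k+2)) v − z‖∞}`
— the design's (β) (cell-mean defect) and (ε) (intra-cell oscillation) for the undressed partners in ONE pointwise letter. -/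
theorem exists_respStep_refine_unit (hLc : 2 ≤ Lc) :
    ∃ c θ κ₂ : ℝ, 0 ≤ c ∧ 0 ≤ θ ∧ θ < 1 ∧ 0 < κ₂ ∧
      ∀ (k : ℕ) (μ : Fin (3 + 1)) (z : Site (3 + 1)) (l : Fin (3 + 1)) (v : Site (3 + 1)),
        |((Lc : ℝ) ^ (k + 1 + 1)) ^ (3 + 2) * respStep (d := 3) 1 (Lc ^ (k + 1 + 1)) μ z l v
            - ((Lc : ℝ) ^ (k + 1)) ^ (3 + 2) * respStep (d := 3) 1 (Lc ^ (k + 1)) μ z l (quo Lc v)|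
          ≤ c * θ ^ k * Real.exp (-(κ₂ * supNorm (quo (Lc ^ (k + 1 + 1)) v - z))) := by
  obtain ⟨c', θ', κ', hc', hθ0, hθ1, hκ', hS⟩ := blockSample_cauchy_three (Lc := Lc) hLc
  refine ⟨c', θ', κ', hc', hθ0, hθ1, hκ', fun k μ z l v => ?_⟩
  rw [respStep_one, respStep_one]
  -- the shorter member's translated argument is the cell label of the taller member's translated argument
  have e1 : quo Lc v - ((Lc ^ (k + 1) : ℕ) : ℤ) • z = quo Lc (v - ((Lc ^ (k + 1 + 1) : ℕ) : ℤ) • z) := by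
    rw [show Lc ^ (k + 1 + 1) = Lc * Lc ^ (k + 1) from pow_succ' Lc (k + 1)]
    exact (quo_sub_mul_zsmul Lc (Lc ^ (k + 1)) v z).symm
  rw [e1]
  refine (hS k l μ (v - ((Lc ^ (k + 1 + 1) : ℕ) : ℤ) • z)).trans (mul_le_mul_of_nonneg_left ?_ (by positivity))
  -- the envelope: `quo N′ (v − N′•z) = quo N′ v − z`, and `‖·‖∞ ≤ |·|₁`
  have hlab : quo (Lc ^ (k + 1 + 1)) (v - ((Lc ^ (k + 1 + 1) : ℕ) : ℤ) • z) = quo (Lc ^ (k + 1 + 1)) v - z := by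
    rw [sub_eq_add_neg, ← smul_neg, quo_add_zsmul, ← sub_eq_add_neg]
  rw [hlab, Real.exp_le_exp, neg_mul, neg_le_neg_iff]
  exact mul_le_mul_of_nonneg_left (supNorm_le_l1 _) hκ'.le

/-- NOT IN PRINT; OUR BOOKKEEPING.  **THE SAME IN THE LEGS' NATIVE CURRENCY** (`d = 3`, every `Lc ≥ 2`, `m = 0`): for ALL `k μ z l v`,
`|Lc^5·respStep 1 (Lc^(k+2)) μ z l v − respStep 1 (Lc^(k+1)) μ z l (quo Lc v)| ≤ c·θ^k·((Lc^{k+1})^5)⁻¹·e^{−κ₂‖quo (Lc^(k+2)) v − z‖∞}` — `θ^k ×` leaf-12's (N1) envelope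
shape of the shorter member (the (β)+(ε) input of the SHAPE-A atom differences of CT-4c, blueprint §2). -/
theorem exists_respStep_refine (hLc : 2 ≤ Lc) :
    ∃ c θ κ₂ : ℝ, 0 ≤ c ∧ 0 ≤ θ ∧ θ < 1 ∧ 0 < κ₂ ∧
      ∀ (k : ℕ) (μ : Fin (3 + 1)) (z : Site (3 + 1)) (l : Fin (3 + 1)) (v : Site (3 + 1)),
        |(Lc : ℝ) ^ (3 + 2) * respStep (d := 3) 1 (Lc ^ (k + 1 + 1)) μ z l v - respStep (d := 3) 1 (Lc ^ (k + 1)) μ z l (quo Lc v)|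
          ≤ c * θ ^ k * (((Lc : ℝ) ^ (k + 1)) ^ (3 + 2))⁻¹ * Real.exp (-(κ₂ * supNorm (quo (Lc ^ (k + 1 + 1)) v - z))) := by
  obtain ⟨c, θ, κ₂, hc, hθ0, hθ1, hκ₂, H⟩ := exists_respStep_refine_unit (Lc := Lc) hLc
  refine ⟨c, θ, κ₂, hc, hθ0, hθ1, hκ₂, fun k μ z l v => ?_⟩
  have hL0 : (0 : ℝ) < Lc := by exact_mod_cast Nat.pos_of_ne_zero (NeZero.ne Lc)
  have hP : (0 : ℝ) < ((Lc : ℝ) ^ (k + 1)) ^ (3 + 2) := by positivity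
  have h := H k μ z l v
  have e : ((Lc : ℝ) ^ (k + 1 + 1)) ^ (3 + 2) * respStep (d := 3) 1 (Lc ^ (k + 1 + 1)) μ z l v
        - ((Lc : ℝ) ^ (k + 1)) ^ (3 + 2) * respStep (d := 3) 1 (Lc ^ (k + 1)) μ z l (quo Lc v)
      = ((Lc : ℝ) ^ (k + 1)) ^ (3 + 2) *
          ((Lc : ℝ) ^ (3 + 2) * respStep (d := 3) 1 (Lc ^ (k + 1 + 1)) μ z l v - respStep (d := 3) 1 (Lc ^ (k + 1)) μ z l (quo Lc v)) := by
    rw [pow_succ]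
    ring
  rw [e, abs_mul, abs_of_pos hP] at h
  calc |(Lc : ℝ) ^ (3 + 2) * respStep (d := 3) 1 (Lc ^ (k + 1 + 1)) μ z l v - respStep (d := 3) 1 (Lc ^ (k + 1)) μ z l (quo Lc v)|
      = (((Lc : ℝ) ^ (k + 1)) ^ (3 + 2))⁻¹ * (((Lc : ℝ) ^ (k + 1)) ^ (3 + 2) *
          |(Lc : ℝ) ^ (3 + 2) * respStep (d := 3) 1 (Lc ^ (k + 1 + 1)) μ z l v - respStep (d := 3) 1 (Lc ^ (k + 1)) μ z l (quo Lc v)|) := by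
        rw [← mul_assoc, inv_mul_cancel₀ hP.ne', one_mul]
    _ ≤ (((Lc : ℝ) ^ (k + 1)) ^ (3 + 2))⁻¹ * (c * θ ^ k * Real.exp (-(κ₂ * supNorm (quo (Lc ^ (k + 1 + 1)) v - z)))) :=
        mul_le_mul_of_nonneg_left h (by positivity)
    _ = c * θ ^ k * (((Lc : ℝ) ^ (k + 1)) ^ (3 + 2))⁻¹ * Real.exp (-(κ₂ * supNorm (quo (Lc ^ (k + 1 + 1)) v - z))) := by ring

end Four

end Summit.QuantumFields.BalabanUV.Beta.GAN24.RespStepRefine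

end
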